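import Mathlib
import HarnessLib
import Summits.QuantumFields.YangMills.Theses.PencilRigidity
import Summits.QuantumFields.YangMills.Theorems.PencilRigidityCurvatureKernelBoundSmearedToLocalDecay
import Summits.QuantumFields.YangMills.Theorems.PencilRigidityCurvatureKernelBoundIffLocalDecay
import Summits.QuantumFields.YangMills.Theorems.PencilRigidityCurvatureKernelBoundSmearedBoundEventuallyOfCrux

/-!
# `CurvatureKernelBound` — the EXACT lattice-side characterisation `crux ↔ SmearedEventually` (support for stmt-QuantumFields-11687)

Crux `stmt-QuantumFields-11687` (`PencilRigidity.CurvatureKernelBound`), line `sixteen-charts-analytic-kernel`, skeleton v18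
(continuation lead c6). **Statement.** `CurvatureKernelBound ↔ E^ev`, where E^ev (`SmearedEventually`) says: for every compact
simple `G`, `r`, `sch` and one-species `S₁` carrying the curvature package `W₁` there are `C`, `η > 0`, `s₁ > 0` such that for every
height `s ∈ (0, s₁)`, radius `0 < ρ ≤ s/2`, real Schwartz `f 0, f 1` supported in the closed `ρ`-balls about `−s e₀`, `+s e₀` and
bounded by `M₀, M₁`, and every `δ > 0`, EVENTUALLY in `k` the renormalised truncated lattice two-point function of the curvature
species obeys `|LS₂(f) − LS₁(f 0) LS₁(f 1)| ≤ C s^(η−10) ((∫|f 0|)(∫|f 1|) + ρ⁸ M₀ M₁) + δ`.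
So the crux is EQUIVALENT to a statement about Wilson's lattice correlations along the scheme, test function by test function;
the registered open stub E^sm `SmearedLatticeWindowBound` (k-UNIFORM through the window `a_k R₀ ≤ s ≤ θ`, lattice `L¹` norms)
exceeds the crux by the quantifier swap `∃ᶠ k ∀ (s, ρ, f)` versus `∀ (s, ρ, f) ∀ᶠ k` and nothing else.
**Proof.** `→` is the landed necessity `SmearedBoundEventuallyOfCrux` (p131636). `←`: per datum (`LocalDecayOfSmearedEventually`),
the lattice tie of `W₁` at `n = 2, 1` passes the eventual bound to the limit (`le_of_tendsto`, then `δ ↓ 0`), the disconnected part is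
`κ² (∫ f 0)(∫ f 1)` with `S₁ 1 = κ∫` (translation invariance, `exists_degreeOne_eq_const_mul_realIntegral`), giving the local two-point
decay T with `A = ‖κ‖² + C⁺ s^(η−10)`, `B = C⁺ s^(η−10)`, `C⁺ = max C 0`, `η_T = min η 10`, `C_T = ‖κ‖² + 2C⁺`, `s₁' = min 1 s₁`,
`r₀ = s/2`; then `crux ← T` is the landed `CurvatureKernelBoundIffLocalDecay` (p131429). [folklore]
-/

noncomputable section

open scoped BigOperators Topology SchwartzMap
open MeasureTheory Filter Set Metric
open Literature.MathematicalPhysics.QuantumLattice Literature.MathematicalPhysics.AQFT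
open Literature.MathematicalPhysics.QuantumFieldTheory

namespace Summit.QuantumFields.YangMills.Theorems.CurvatureKernel

open TwoPointLocal SemiDegenerate BoundedRenormalisation SmearedToLocalDecayAux in
/-- **`LocalDecayOfSmearedEventually`** (per datum; support for stmt-QuantumFields-11687, line `sixteen-charts-analytic-kernel`):
ONE `W₁`-datum + the testwise EVENTUAL smeared bound on its renormalised truncated lattice two-point function ⇒ the local two-point
decay T for that family (`η_T = min η 10`, `C_T = ‖κ‖² + 2 max C 0`, `s₁' = min 1 s₁`). [folklore] -/
theorem LocalDecayOfSmearedEventually : open Literature.MathematicalPhysics.QuantumLattice Literature.MathematicalPhysics.AQFT Literature.MathematicalPhysics.QuantumFieldTheory in ∀ (G : Type) [Group G] [TopologicalSpace G] [IsTopologicalGroup G] [CompactSpace G] [MeasurableSpace G] [BorelSpace G], IsCompactSimpleLieGroup G → ∀ (r : LatticeRep G) (sch : SpeciesScheme (YMSpecies G)) (S₁ : SchwingerFamily (EuclideanSpace ℝ (Fin 4))), ((∀ (n : ℕ), n ≠ 0 → ∀ (f : Fin n → SchwartzMap (EuclideanSpace ℝ (Fin 4)) ℝ) (F : SchwartzMap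 (Fin n → (EuclideanSpace ℝ (Fin 4))) ℂ), IsTensorOf F (fun i => ofRealTest (f i)) → IsOffDiagonal F → Filter.Tendsto (fun k : ℕ => ((latticeSchwinger r.ρ sch (fun s => s.F) k n (fun _ => r.curvature) f : ℝ) : ℂ)) Filter.atTop (nhds (S₁ n F))) ∧ (S₁.toLabelled.IsNormalized ∧ S₁.toLabelled.IsHermitian ∧ S₁.toLabelled.HasLinearGrowth ∧ S₁.toLabelled.IsReflectionPositive ∧ S₁.toLabelled.IsSymmetric ∧ S₁.toLabelled.HasClusterProperty) ∧ (∀ (n : ℕ) (a : (EuclideanSpace ℝ (Fin 4))) (F : SchwartzMap (Fin n → (EuclideanSpace ℝ (Fin 4))) ℂ), IsOffDiagonal F → S₁ n (translateMulti a F) = S₁ n F) ∧ (∀ (R : (EuclideanSpace ℝ (Fin 4)) ≃ₗᵢ[ℝ] (EuclideanSpace ℝ (Fin 4))), LinearMap.det (R.toLinearEquiv : (EuclideanSpace ℝ (Fin 4)) →ₗ[ℝ] (EuclideanSpace ℝ (Fin 4))) = 1 → (∀ i : Fin 4, ∃ j : Fin 4, R (EuclideanSpace.single i 1) = EuclideanSpace.single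 j 1 ∨ R (EuclideanSpace.single i 1) = -EuclideanSpace.single j 1) → ∀ (n : ℕ) (F : SchwartzMap (Fin n → (EuclideanSpace ℝ (Fin 4))) ℂ), IsOffDiagonal F → S₁ n (linActMulti R F) = S₁ n F) ∧ (∃ Δ : ℝ, 0 < Δ ∧ S₁.toLabelled.HasMassGap Δ ∧ HasLatticeMassGap r sch Δ)) → (∃ (C η s₁ : ℝ), 0 < η ∧ 0 < s₁ ∧ ∀ (s : ℝ), 0 < s → s < s₁ → ∀ (ρ : ℝ), 0 < ρ → ρ ≤ s / 2 → ∀ (f : Fin 2 → SchwartzMap (EuclideanSpace ℝ (Fin 4)) ℝ) (M₀ M₁ : ℝ), tsupport ((f 0 : SchwartzMap (EuclideanSpace ℝ (Fin 4)) ℝ) : (EuclideanSpace ℝ (Fin 4)) → ℝ) ⊆ Metric.closedBall (EuclideanSpace.single (0 : Fin 4) (-s)) ρ → tsupport ((f 1 : SchwartzMap (EuclideanSpace ℝ (Fin 4)) ℝ) : (EuclideanSpace ℝ (Fin 4)) → ℝ) ⊆ Metric.closedBall (EuclideanSpace.single (0 : Fin 4) s) ρ → (∀ x, |f 0 x| ≤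 M₀) → (∀ x, |f 1 x| ≤ M₁) → ∀ (δ : ℝ), 0 < δ → ∀ᶠ k in Filter.atTop, |latticeSchwinger r.ρ sch (fun s => s.F) k 2 (fun _ => r.curvature) f - latticeSchwinger r.ρ sch (fun s => s.F) k 1 (fun _ => r.curvature) (fun _ => f 0) * latticeSchwinger r.ρ sch (fun s => s.F) k 1 (fun _ => r.curvature) (fun _ => f 1)| ≤ C * s ^ (η - 10) * ((∫ x : (EuclideanSpace ℝ (Fin 4)), |f 0 x|) * (∫ x : (EuclideanSpace ℝ (Fin 4)), |f 1 x|) + ρ ^ 8 * M₀ * M₁) + δ) → ∃ (C η s₁ : ℝ), 0 < η ∧ 0 < s₁ ∧ (∀ (s : ℝ), 0 < s → s < s₁ → ∃ (r₀ A B : ℝ), 0 < r₀ ∧ 0 ≤ A ∧ 0 ≤ B ∧ A + B ≤ C * s ^ (η - 10) ∧ (∀ (r : ℝ), 0 < r → r ≤ r₀ → ∀ (f : Fin 2 → SchwartzMap (EuclideanSpace ℝ (Fin 4)) ℝ) (F : SchwartzMap (Fin 2 → (EuclideanSpace ℝ (Fin 4))) ℂ) (M₀ M₁ : ℝ), IsTensorOf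 F (fun i => ofRealTest (f i)) → tsupport ((f 0 : SchwartzMap (EuclideanSpace ℝ (Fin 4)) ℝ) : (EuclideanSpace ℝ (Fin 4)) → ℝ) ⊆ Metric.closedBall (EuclideanSpace.single (0 : Fin 4) (-s)) r → tsupport ((f 1 : SchwartzMap (EuclideanSpace ℝ (Fin 4)) ℝ) : (EuclideanSpace ℝ (Fin 4)) → ℝ) ⊆ Metric.closedBall (EuclideanSpace.single (0 : Fin 4) s) r → (∀ x, |f 0 x| ≤ M₀) → (∀ x, |f 1 x| ≤ M₁) → ‖S₁ 2 F‖ ≤ A * (∫ x : (EuclideanSpace ℝ (Fin 4)), |f 0 x|) * (∫ x : (EuclideanSpace ℝ (Fin 4)), |f 1 x|) + B * r ^ 8 * M₀ * M₁)) := by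
  intro G _ _ _ _ _ _ _ r sch S₁ hW₁ hEv
  obtain ⟨htie, -, htr, -, -⟩ := hW₁
  obtain ⟨C, η, s₁, hη, hs₁, hev⟩ := hEv
  obtain ⟨κ, hκ⟩ := exists_degreeOne_eq_const_mul_realIntegral S₁ htr
  -- constants
  obtain ⟨Cp, hCCp, hCpnn⟩ : ∃ Cp : ℝ, C ≤ Cp ∧ 0 ≤ Cp := ⟨max C 0, le_max_left _ _, le_max_right _ _⟩
  refine ⟨‖κ‖ ^ 2 + 2 * Cp, min η 10, min 1 s₁, lt_min hη (by norm_num), lt_min one_pos hs₁, ?_⟩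
  intro s hs hs₁'
  have hs1 : s ≤ 1 := hs₁'.le.trans (min_le_left _ _)
  have hss₁ : s < s₁ := lt_of_lt_of_le hs₁' (min_le_right _ _)
  -- the constant of the smeared bound at separation `s`
  obtain ⟨D, hDdef, hDnn⟩ : ∃ D : ℝ, D = Cp * s ^ (η - 10) ∧ 0 ≤ D := ⟨_, rfl, by positivity⟩
  refine ⟨s / 2, ‖κ‖ ^ 2 + D, D, half_pos hs, by positivity, hDnn, ?_, ?_⟩
  · -- `A + B ≤ C_T s^(η_T − 10)`
    have key := const_add_mul_rpow_le (A := ‖κ‖ ^ 2) (Q := 2 * Cp) (η := η)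
      (by positivity) (by positivity) hs hs1
    have hBD : ‖κ‖ ^ 2 + D + D = ‖κ‖ ^ 2 + 2 * Cp * s ^ (η - 10) := by rw [hDdef]; ring
    linarith
  · intro ρ hρ hρs f F M₀ M₁ hFt hsupp₀ hsupp₁ hM₀ hM₁
    have hM₀nn : 0 ≤ M₀ := (abs_nonneg _).trans (hM₀ 0)
    have hM₁nn : 0 ≤ M₁ := (abs_nonneg _).trans (hM₁ 0)
    -- the two closed balls are disjoint, so `F` is off-diagonal
    have hdisj : Disjoint (tsupport ((f 0 : 𝓢(EuclideanSpace ℝ (Fin 4), ℝ)) : EuclideanSpace ℝ (Fin 4) → ℝ))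
        (tsupport ((f 1 : 𝓢(EuclideanSpace ℝ (Fin 4), ℝ)) : EuclideanSpace ℝ (Fin 4) → ℝ)) :=
      Disjoint.mono hsupp₀ hsupp₁ (disjoint_closedBall_single hs hρs)
    have hFoff : IsOffDiagonal F := isOffDiagonal_of_isTensorOf_of_disjoint hFt hdisj
    obtain ⟨F₀, hF₀⟩ := exists_isTensorOf (n := 1) (fun _ : Fin 1 => ofRealTest (f 0))
    obtain ⟨F₁, hF₁⟩ := exists_isTensorOf (n := 1) (fun _ : Fin 1 => ofRealTest (f 1))
    -- the lattice tie of `W₁` at `n = 2, 1`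
    have hu := htie 2 two_ne_zero f F hFt hFoff
    have hv := htie 1 one_ne_zero (fun _ => f 0) F₀ hF₀ (HypercubicLimit.Negative.isOffDiagonal_fin_one F₀)
    have hw := htie 1 one_ne_zero (fun _ => f 1) F₁ hF₁ (HypercubicLimit.Negative.isOffDiagonal_fin_one F₁)
    set I₀ : ℝ := ∫ x : EuclideanSpace ℝ (Fin 4), |f 0 x| with hI₀
    set I₁ : ℝ := ∫ x : EuclideanSpace ℝ (Fin 4), |f 1 x| with hI₁
    have hI₀nn : 0 ≤ I₀ := integral_nonneg fun x => abs_nonneg _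
    have hI₁nn : 0 ≤ I₁ := integral_nonneg fun x => abs_nonneg _
    -- (1) the eventual smeared bound passes to the limit, for every `δ > 0`
    have hZδ : ∀ δ : ℝ, 0 < δ → ‖S₁ 2 F - S₁ 1 F₀ * S₁ 1 F₁‖ ≤ D * (I₀ * I₁ + ρ ^ 8 * M₀ * M₁) + δ := by
      intro δ hδ
      have hlat : ∀ᶠ k in atTop,
          ‖((latticeSchwinger r.ρ sch (fun s => s.F) k 2 (fun _ => r.curvature) f : ℝ) : ℂ) -
            ((latticeSchwinger r.ρ sch (fun s => s.F) k 1 (fun _ => r.curvature) (fun _ => f 0) : ℝ) : ℂ) *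
            ((latticeSchwinger r.ρ sch (fun s => s.F) k 1 (fun _ => r.curvature) (fun _ => f 1) : ℝ) : ℂ)‖ ≤
          D * (I₀ * I₁ + ρ ^ 8 * M₀ * M₁) + δ := by
        filter_upwards [hev s hs hss₁ ρ hρ hρs f M₀ M₁ hsupp₀ hsupp₁ hM₀ hM₁ δ hδ] with k hk
        rw [← Complex.ofReal_mul, ← Complex.ofReal_sub, Complex.norm_real, Real.norm_eq_abs]
        refine hk.trans ?_
        have hX : 0 ≤ I₀ * I₁ + ρ ^ 8 * M₀ * M₁ := by positivity
        have hCD : C * s ^ (η - 10) ≤ D := by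
          rw [hDdef]
          exact mul_le_mul_of_nonneg_right hCCp (Real.rpow_nonneg hs.le _)
        nlinarith
      exact le_of_tendsto (hu.sub (hv.mul hw)).norm hlat
    have hZ : ‖S₁ 2 F - S₁ 1 F₀ * S₁ 1 F₁‖ ≤ D * (I₀ * I₁ + ρ ^ 8 * M₀ * M₁) :=
      le_of_forall_pos_le_add fun δ hδ => hZδ δ hδ
    -- (2) the disconnected part is `κ² (∫ f₀)(∫ f₁)`, bounded by `‖κ‖² (∫|f₀|)(∫|f₁|)`
    have hS1F₀ : S₁ 1 F₀ = κ * ((∫ y, f 0 y : ℝ) : ℂ) := hκ (f 0) F₀ hF₀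
    have hS1F₁ : S₁ 1 F₁ = κ * ((∫ y, f 1 y : ℝ) : ℂ) := hκ (f 1) F₁ hF₁
    rw [hS1F₀, hS1F₁] at hZ
    have hP := norm_disconnected_le κ f
    -- (3) assembly
    have hfin := TwoPointLocal.norm_le_of_norm_sub_le hZ hP
    have hring : D * (I₀ * I₁ + ρ ^ 8 * M₀ * M₁) = D * I₀ * I₁ + D * ρ ^ 8 * M₀ * M₁ := by ring
    rw [hring] at hfin
    have : ‖κ‖ ^ 2 * I₀ * I₁ + (D * I₀ * I₁ + D * ρ ^ 8 * M₀ * M₁) =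
        (‖κ‖ ^ 2 + D) * I₀ * I₁ + D * ρ ^ 8 * M₀ * M₁ := by ring
    linarith

/-- **`CurvatureKernelBoundIffSmearedEventually`** (support for stmt-QuantumFields-11687, skeleton v18 of line
`sixteen-charts-analytic-kernel`): the crux `CurvatureKernelBound` is EQUIVALENT to the testwise, eventually-in-`k` smeared bound
on the renormalised truncated lattice two-point function of the curvature species for every `W₁`-datum — its exact form in
lattice currency (`→`: `SmearedBoundEventuallyOfCrux`; `←`: `LocalDecayOfSmearedEventually` then `CurvatureKernelBoundIffLocalDecay`). [folklore] -/
theorem CurvatureKernelBoundIffSmearedEventually : open Literature.MathematicalPhysics.QuantumLattice Literature.MathematicalPhysics.AQFT Literature.MathematicalPhysics.QuantumFieldTheory in Summit.QuantumFields.YangMills.Theses.PencilRigidity.CurvatureKernelBound ↔ (∀ (G : Type) [Group G] [TopologicalSpace G] [IsTopologicalGroup G] [CompactSpace G] [MeasurableSpace G] [BorelSpace G], IsCompactSimpleLieGroup G → ∀ (r : LatticeRep G) (sch : SpeciesScheme (YMSpecies G)) (S₁ : SchwingerFamily (EuclideanSpace ℝ (Fin 4))), ((∀ (n : ℕ), n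 ≠ 0 → ∀ (f : Fin n → SchwartzMap (EuclideanSpace ℝ (Fin 4)) ℝ) (F : SchwartzMap (Fin n → (EuclideanSpace ℝ (Fin 4))) ℂ), IsTensorOf F (fun i => ofRealTest (f i)) → IsOffDiagonal F → Filter.Tendsto (fun k : ℕ => ((latticeSchwinger r.ρ sch (fun s => s.F) k n (fun _ => r.curvature) f : ℝ) : ℂ)) Filter.atTop (nhds (S₁ n F))) ∧ (S₁.toLabelled.IsNormalized ∧ S₁.toLabelled.IsHermitian ∧ S₁.toLabelled.HasLinearGrowth ∧ S₁.toLabelled.IsReflectionPositive ∧ S₁.toLabelled.IsSymmetric ∧ S₁.toLabelled.HasClusterProperty) ∧ (∀ (n : ℕ) (a : (EuclideanSpace ℝ (Fin 4))) (F : SchwartzMap (Fin n → (EuclideanSpace ℝ (Fin 4))) ℂ), IsOffDiagonal F → S₁ n (translateMulti a F) = S₁ n F) ∧ (∀ (R : (EuclideanSpace ℝ (Fin 4)) ≃ₗᵢ[ℝ] (EuclideanSpace ℝ (Fin 4))), LinearMap.det (R.toLinearEquiv : (EuclideanSpace ℝ (Fin 4)) →ₗ[ℝ] (EuclideanSpace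 ℝ (Fin 4))) = 1 → (∀ i : Fin 4, ∃ j : Fin 4, R (EuclideanSpace.single i 1) = EuclideanSpace.single j 1 ∨ R (EuclideanSpace.single i 1) = -EuclideanSpace.single j 1) → ∀ (n : ℕ) (F : SchwartzMap (Fin n → (EuclideanSpace ℝ (Fin 4))) ℂ), IsOffDiagonal F → S₁ n (linActMulti R F) = S₁ n F) ∧ (∃ Δ : ℝ, 0 < Δ ∧ S₁.toLabelled.HasMassGap Δ ∧ HasLatticeMassGap r sch Δ)) → ∃ (C η s₁ : ℝ), 0 < η ∧ 0 < s₁ ∧ ∀ (s : ℝ), 0 < s → s < s₁ → ∀ (ρ : ℝ), 0 < ρ → ρ ≤ s / 2 → ∀ (f : Fin 2 → SchwartzMap (EuclideanSpace ℝ (Fin 4)) ℝ) (M₀ M₁ : ℝ), tsupport ((f 0 : SchwartzMap (EuclideanSpace ℝ (Fin 4)) ℝ) : (EuclideanSpace ℝ (Fin 4)) → ℝ) ⊆ Metric.closedBall (EuclideanSpace.single (0 : Fin 4) (-s)) ρ → tsupport ((f 1 : SchwartzMap (EuclideanSpace ℝ (Fin 4)) ℝ) : (EuclideanSpace ℝ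 (Fin 4)) → ℝ) ⊆ Metric.closedBall (EuclideanSpace.single (0 : Fin 4) s) ρ → (∀ x, |f 0 x| ≤ M₀) → (∀ x, |f 1 x| ≤ M₁) → ∀ (δ : ℝ), 0 < δ → ∀ᶠ k in Filter.atTop, |latticeSchwinger r.ρ sch (fun s => s.F) k 2 (fun _ => r.curvature) f - latticeSchwinger r.ρ sch (fun s => s.F) k 1 (fun _ => r.curvature) (fun _ => f 0) * latticeSchwinger r.ρ sch (fun s => s.F) k 1 (fun _ => r.curvature) (fun _ => f 1)| ≤ C * s ^ (η - 10) * ((∫ x : (EuclideanSpace ℝ (Fin 4)), |f 0 x|) * (∫ x : (EuclideanSpace ℝ (Fin 4)), |f 1 x|) + ρ ^ 8 * M₀ * M₁) + δ) :=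
  ⟨SmearedBoundEventuallyOfCrux, fun hEv => CurvatureKernelBoundIffLocalDecay.mpr
    fun G _ _ _ _ _ _ hG r sch S₁ hW₁ => LocalDecayOfSmearedEventually G hG r sch S₁ hW₁ (hEv G hG r sch S₁ hW₁)⟩

end Summit.QuantumFields.YangMills.Theorems.CurvatureKernel

end
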